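import Literature.AnabelianGeometry.AbsoluteAnabelian.AbsTopIThm26vFullSigmaProofs
import HarnessLib

/-!
# [AbsTopI] Thm 2.6 (v), general form: the residual in the shape of Lemma 2.7 (iii)

S. Mochizuki, *Topics in Absolute Anabelian Geometry I: Generalities* (2012) [AbsTopI], Thm 2.6 (v)
p. 22 and its proof p. 24; Thm 2.6 (iii) second clause, proof p. 23 l. 36–45 ("If the cardinality
of `θ¹(Π)` is `≥ 2` [...] `ε²_{l′}(Π) ≥ δ²_{l′}(Π) ≥ 1`, so `l′ ∈ θ²(Π)`" — via the injections of
Lemma 2.7 (iii)).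

PROOF-ONLY sequel (no definitions, no named facts) of this seat's `AbsTopIThm26vFullSigmaProofs.lean`.
The closer there (`MLFBase.thm26vFull_of_isProSet_of_tfg`) takes the second clause of (iii) per open
`H` as an EQUALITY `thetaSet H 2 = Primes`; abc-iut-w6-d073's residual form of (iii)
(`thm26iii_iff_of_isProSet`, p440330) and the cell's typing of Lemma 2.7 (iii) (row «LEM27iii-TYPE»,
abc-iut-w5-d058) deliver the INCLUSION `Σ ⊆ θ²(H)`.  This file records the conversion once, so that
the Lemma 2.7 (iii) fact plugs in by name:

* `thetaSet_subset_primes` — `θʲ(G) ⊆ Primes` by definition of `thetaSet`;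
* `MLFBase.thm26vFull_of_isProSet_of_subset` — `E.Thm26vFull B` from `Δ` tfg (Prop 2.2), `Π` tfg
  (Thm 2.6 (ii) clause one), `Δ` pro-`Σ`, and — only when every prime lies in `Σ` — the rank identity
  of (ii) per open `Π′` and the INCLUSION form of (iii) clause two per open `H`:
  `2 ≤ |θ¹(H)| → {l ∈ Σ | l prime} ⊆ θ²(H)`;
* `MLFBase.thm26vFull_of_starCondition_of_subset` — the `Σ = Primes` regime of [IUTchI–III] from the
  printed hypotheses of [AbsAnab] Lemma 1.1.4 (ii) (splitting + (∗)), `Π` tfg, and that inclusion.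

HONEST FRAMING: refereed, undisputed statement; the inclusion is exactly the content of [AbsTopI]
Lemma 2.7 (iii) (Tate module of the Albanese — geometric origin), NOT a theorem of the abstract
hypotheses (abc-iut finding F-w6d073-1); abc-iut cell, seat abc-iut-w6-d034; nothing here bears on
[IUTchIII] Cor. 3.12.
-/

noncomputable section

namespace Literature.AnabelianGeometry.AbsoluteAnabelian

universe u

/-- `θʲ(G) ⊆ Primes`: by definition `thetaSet G j = {l | ∃ _ : l.Prime, …}`.
[cite: MochizukiAbsTopI2012, Thm 2.6 p.21] -/
theorem thetaSet_subset_primes (G : Type u) [Group G] [TopologicalSpace G] [IsTopologicalGroup G]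
    (j : ℕ) : thetaSet G j ⊆ {l | l.Prime} := fun _ hl => hl.1

namespace FundamentalExtension

variable {E : FundamentalExtension.{0}}

/-- **[AbsTopI] Thm 2.6 (v), general form, modulo the INCLUSION form of (iii) clause two** (the shape
delivered by Lemma 2.7 (iii)): for every extension with MLF base data and `Σ ⊆ Primes`, GIVEN `Δ` tfg
(Prop 2.2), `Π` tfg (Thm 2.6 (ii) clause one), `Δ` pro-`Σ`, and — only if every prime lies in `Σ` —
the rank identity of (ii) for every open `Π′` and "`|θ¹(H)| ≥ 2 ⇒ Σ ⊆ θ²(H)`" for every open `H`: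
`E.Thm26vFull B`. [cite: MochizukiAbsTopI2012, Thm 2.6 (v) p.22] -/
theorem MLFBase.thm26vFull_of_isProSet_of_subset (B : E.MLFBase) (S : Set ℕ)
    (hS : S ⊆ {q | q.Prime}) (hΔ : E.GeomTFG) (htfg : IsTopologicallyFinitelyGenerated E.arith)
    (hΔS : IsProSet E.geom S)
    (hQ : (∀ q : ℕ, q.Prime → q ∈ S) → ∀ (P : Subgroup E.arith), IsOpen (P : Set E.arith) →
      ∃ m : ℕ, ∀ (l : ℕ) [Fact l.Prime],
        freeProlRank P l = freeProlRank (P.map E.aug.toMonoidHom) l + m)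
    (hL : (∀ q : ℕ, q.Prime → q ∈ S) → ∀ (H : Subgroup E.arith), IsOpen (H : Set E.arith) →
      2 ≤ (thetaSet H 1).encard → {l ∈ S | l.Prime} ⊆ thetaSet H 2) :
    E.Thm26vFull B := by
  refine MLFBase.thm26vFull_of_isProSet_of_tfg B S hS hΔ htfg hΔS hQ fun hall H hH h2 => ?_
  refine Set.Subset.antisymm (thetaSet_subset_primes H 2) fun l hl => ?_
  exact hL hall H hH h2 ⟨hall l hl, hl⟩

/-- **The `Σ = Primes` regime of [IUTchI–III], modulo exactly the Lemma 2.7 (iii) inclusion**: for an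
extension with MLF base data that splits over an open subgroup of `G`, with `Δ` tfg and (∗)
([AbsAnab] Lemma 1.1.4 (ii) hypotheses — they discharge the rank identity,
`exists_freeProlRank_open_eq_add`) and `Π` tfg: if "`|θ¹(H)| ≥ 2 ⇒ Primes ⊆ θ²(H)`" for every open
`H ⊆ Π`, then `E.Thm26vFull B`. [cite: MochizukiAbsTopI2012, Thm 2.6 (v) p.22] -/
theorem MLFBase.thm26vFull_of_starCondition_of_subset (B : E.MLFBase)
    (hs : E.SplitsOverOpenSubgroup) (hΔ : E.GeomTFG) (hstar : E.StarCondition)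
    (htfg : IsTopologicallyFinitelyGenerated E.arith)
    (hL : ∀ (H : Subgroup E.arith), IsOpen (H : Set E.arith) →
      2 ≤ (thetaSet H 1).encard → {l | l.Prime} ⊆ thetaSet H 2) :
    E.Thm26vFull B := by
  refine MLFBase.thm26vFull_of_isProSet_of_subset B {q | q.Prime} subset_rfl hΔ htfg
    ⟨fun U _ _ q hq _ => hq⟩ (fun _ P hP => ?_) (fun _ H hH h2 l hl => hL H hH h2 hl.2)
  obtain ⟨m, hm⟩ := E.exists_freeProlRank_open_eq_add hs hstar P hP
  exact ⟨m, fun l _ => hm l⟩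

end FundamentalExtension

end Literature.AnabelianGeometry.AbsoluteAnabelian

end
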